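import Summits.QuantumFields.QCD.Theses.HeatSlicedQuarks
import Summits.QuantumFields.QCD.Theses.GradientFlowSpecies
import Summits.QuantumFields.QCD.Theorems.GluonicCompletion.Negative.Threshold
import Summits.QuantumFields.QCD.Theorems.RobustYangMillsHandover.Negative.GapClauses
import Summits.QuantumFields.QCD.Theorems.RobustYangMillsHandover.Negative.WithoutNontriviality
import Literature.MathematicalPhysics.QuantumFieldTheory.QuasiLocalGaugePerturbation
import Literature.MathematicalPhysics.QuantumLattice.WilsonFermionBlockAveraging
import Literature.Probability.LatticeModels.Correlations
import HarnessLib.Audit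

/-!
# Line `geometric-mean-handover` — skeleton for crux `RobustYangMillsHandover` (stmt-QuantumFields-8892)

Crux (route `HeatSlicedQuarks`, typed): `RobustYangMillsHandover := ContinuumQCDExists → QCD`.

Idea card `Ideas/geometric-mean-handover.md` (+ triage r1 ×3, all pass) with the shared head
`existence-pays-the-continuum-half`: hand the heavy quarks over to PURE lattice Yang–Mills at a block
scale `ℓ₀ = t/Λ′` that is a fixed small fraction `t` of the matched Yang–Mills correlation length
(the card's geometric-mean choice `ℓ₀ = ξ (Λ′/M₀)^{1/6}` is the special case optimising two errors at
once; at fixed `t` the block activities are `O((ℓ₀ M₀)⁻²) = O(t⁻²(Λ′/M₀)²)`, still `→ 0` per correlation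
volume, which is all the Kotecký–Preiss step needs — triage r1-1 and r1-3 "merge with
threshold-irrelevance-squeeze"): the unquenched measure, restricted to the σ-algebra of axial block
links at scale `ℓ₀`, is the Wilson measure at the matched `β_eff(k)` tilted by `e^{-W}` with `W` a
quasi-local block perturbation of SMALL weighted norm (`FlowComparison`, the bet), pure lattice
Yang–Mills along every `N_f = 0` asymptotically free sequence is tree-mixing at every block fraction `t`
(`MixingYM`, the Yang–Mills-strength input, β-universal and all-order but with NO action-direction
clause), a Kotecký–Preiss expansion around a tree-mixing reference transfers exponential clustering to
the tilted measure once the norm is below a threshold depending only on the mixing constants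
(`KPTransfer`, abstract lattice theorem), and fine lattice-QCD correlations of all gauge-invariant local
observables are read off the clustering of block proxies plus heavy quark lines (`FineFromBlock`).
With the continuum half paid by `GradientFlowSpecies.GapTransfer` (stmt-8923) this proves the crux —
EXCEPT on mass tuples with extreme flavour hierarchies (see FINDING), which are isolated in the sixth
stub `LightRemnantLatticeGap`.

## Stubs (registered; `sorry` only here) and composition

* `stub_gapTransfer : GradientFlowSpecies.GapTransfer` — continuum half (shared item stmt-8923, M; same name and
  signature as in Lines/existence-pays-the-continuum-half.lean, so the registered stub is shared).
* `stub_MixingYM : MixingYM` — YM input (open-problem strength; not for provers now).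
* `stub_KPTransfer : KPTransfer` — abstract KP-around-a-mixing-reference theorem (L).
* `stub_FlowComparison : FlowComparison` — THE BET: block representation + smallness (XL).
* `stub_FineFromBlock : FineFromBlock` — fine correlations from block clustering + quark lines (L).
* `stub_LightRemnantLatticeGap : LightRemnantLatticeGap` — hierarchical tuples (open; NOT addressed
  by this idea, see FINDING).
* `RobustYangMillsHandover_of_parts : GapTransfer → MixingYM → KPTransfer → FlowComparison → FineFromBlock →
  LightRemnantLatticeGap → (ContinuumQCDExists → QCD)` — real proof (pure logic + `qcdOf_iff_threshold`),
  and `RobustYangMillsHandover_of : RobustYangMillsHandover` — the same applied to the six `stub_*`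
  (the audited skeleton theorem; the stub Props are plain defs: obligation tags are gate-reserved).

## FINDING (planner, 2026-08-16): thresholds do not temper mass RATIOS

`C⁺ = HonestHeavyLatticeGap` (≅ `GradientFlowSpecies.MassiveLatticeGap`, stmt-8922; triage r1-3) asks
the lattice gap for ALL tuples above a per-regularisation threshold, hence for all splittings. The
matched `N_f = 0` scale is `Λ′(m) = Λ^{1-2N_f/33} ∏_f m_f^{2/33}` (`HeavyThresholdYMBridge.CouplingMatching`),
so the handover parameter `Λ′(m)/m_min` is unbounded along hierarchies at fixed lightest mass
(`N_f = 3`: `m_s → ∞` at fixed `m_u, m_d` gives `Λ₂ = Λ^{27/29} m_s^{2/29} → ∞`, the chiral regime of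
`N_f = 2` relative to its own scale; `N_f = 2`: light `N_f = 1`). No handover to pure Yang–Mills covers
those tuples; the mechanism below proves `C⁺` on every ratio-tempered cone `{m_f ≤ Rm · m_g}` with a
threshold `M₁(reg, Rm)`, and the complement is the explicit open stub `LightRemnantLatticeGap`
(`matchedScale_ratio_tendsto_atTop` below records the arithmetic). This affects every heavy-threshold line on this
crux and the sibling items 8922 / 8795 / 8794 alike.

## Disproof.lean used (cdisprove cycles 1–2)

§1 (`not_handover_iff`, `handover_iff_target_iff_qcd`): honoured — X₀ is consumed only through its
regularisation's honesty (`Honest`) and through `GapTransfer`; no stub uses X₀'s truth value.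
§2 (`handoverWithoutNontriviality_iff_qcd`, landed `Negative/WithoutNontriviality.lean`, imported): the
line uses the non-triviality clauses at `stub_FlowComparison` / `stub_FineFromBlock`, whose hypothesis
`Honest reg` carries them (they pin `m_crit`, `Z_m` to the honest ones, i.e. quarks light at the cutoff,
heavy only below `1/M₀`); for the junk `canonicalAF` both stubs are void. §5/§8 (threshold forms): the
head is the per-regularisation threshold form `∀ reg, ∃ M` (weaker than `HandoverAboveThreshold`, whose
`M₀`-before-`reg` form is physically false — triage r1-2), and the FINDING above corrects the reading
"only the heavy regime is needed": true for the common OFFSET, false for RATIOS. §6 (`sameReg_iff`,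
`LatticeGapped`, landed `Negative/GapClauses.lean`, imported: `hasLatticeMassGap_anti`): the lattice
half is stated as `LatticeGapped reg m` on `reg.scheme m 0 0`. §9(i) (`quarkLoopShift_tendsto_atTop`):
`FlowComparison` matches `β_eff` NON-perturbatively (the marginal log is absorbed, `BlockRep` is an
identity at the matched coupling; only the irrelevant remainder is asked small, at FIXED `t`, in `M₀`).
§9(ii) (`scheme_mq_eventually_neg`; landed `Negative/FreeWilsonModes.numericalRange_neg_of_mass_neg`):
no stub cites fine-lattice accretivity (8875); block-scale quark-line decay is `FineFromBlock`'s own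
burden. `-- Targets`: none at plan time.
-/

noncomputable section

open MeasureTheory Filter Topology
open Literature.MathematicalPhysics.QuantumFieldTheory
open Literature.MathematicalPhysics.QuantumLattice
open Literature.MathematicalPhysics.AQFT
open Literature.Probability.LatticeModels (ursell)
open Summit.QuantumFields.QCD.Theses
open Summit.QuantumFields.QCD.Theses.HeatSlicedQuarks

namespace Summit.QuantumFields.QCD.Cruxes.RobustYangMillsHandover.GeometricMeanHandover

/-! ## §0 Vocabulary -/

/-- The colour group `SU(3)` as a type. -/
abbrev SU3 : Type := ↥(Matrix.specialUnitaryGroup (Fin 3) ℂ)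

/-- The fundamental representation of `SU(3)` (the tree's `fundamentalRep (Fin 3)`). -/
abbrev ρ₃ : SU3 →* Matrix (Fin 3) (Fin 3) ℂ := fundamentalRep (Fin 3)

/-- **Honesty of a regularisation** (= Disproof.lean's `IsTargetReg`, the `∃ reg`-body of the route
target X₀ at one `N_f`): `HasMassScaling` and, for every positive mass tuple, OS data along
`reg.scheme m z shift` with `IsQCDAlong` and the three non-triviality clauses. The only part of X₀ a
proof can lean on (Disproof §2). [folklore] -/
def Honest {Nf : ℕ} (reg : QCDRegularisation Nf) : Prop :=
  reg.HasMassScaling ∧ ∀ m : Fin Nf → ℝ, (∀ f, 0 < m f) →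
    ∃ (z shift : QCDField Nf → ℕ → ℝ) (T : OSData (QCDField Nf) 4),
      IsQCDAlong (reg.scheme m z shift) T ∧ T.IsNontrivial QCDField.glue ∧
        T.IsNonGaussian QCDField.glue ∧ ∀ f g : Fin Nf, f ≠ g → T.IsNontrivial (QCDField.pseudoRe f g)

/-- **The lattice-gap content at `(reg, m)`** (Disproof §6): some `Δ > 0` gaps lattice QCD along the
bare trajectory `m_f(k) = m_crit(k) + a_k m_f / Z_m(k)`, uniformly in the volume; the clause does not
read `z, shift` (`Negative.hasLatticeMassGap_scheme_indep`). [folklore] -/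
def LatticeGapped {Nf : ℕ} (reg : QCDRegularisation Nf) (m : Fin Nf → ℝ) : Prop :=
  ∃ Δ : ℝ, 0 < Δ ∧ (reg.scheme m 0 0).HasLatticeMassGap Δ

/-- **Block factor** `b = ⌊t/(Λ′ a)⌋`: the handover block side in lattice units when the physical
block length is the fraction `t` of the Yang–Mills length `1/Λ′` and the spacing is `a`. Shared
verbatim by `MixingYM`, `FlowComparison`, `FineFromBlock` so that their block scales agree
definitionally. [folklore] -/
def blockFactor (t Λ' a : ℝ) : ℕ := ⌊t / (Λ' * a)⌋₊

section Lattice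

variable {G : Type} [Group G] [MeasurableSpace G] {N : ℕ} [NeZero N]

/-- **The σ-algebra of axial block links at scale `b`** on the torus of side `N`: generated by the
straight parallel transporters from each block corner `y` (`blockCorners b`) along each axis to the
NEXT corner (length `b`, or `N - y_μ` for the truncated last block, so that endpoints are corners and
the block links form an honest, uneven block torus; `transport` is the tree's ordered link product).
"Blocked to scale `ℓ₀`" below always means "restricted to this σ-algebra". [cite: Balaban1984Propagators, §1 (1.4)–(1.6)] -/
@[reducible] def blockSigma (b : ℕ) : MeasurableSpace (GaugeConfig 4 N G) :=
  MeasurableSpace.comap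
    (fun (U : GaugeConfig 4 N G) (y : ↥(blockCorners (d := 4) (L := N) b)) (μ : Fin 4) =>
      transport U (y : Site 4 N) (List.replicate (min b (N - ((y : Site 4 N) μ).val)) μ))
    inferInstance

variable {b : ℕ}

/-- The tilt weight `e^{-W(U)}` of a quasi-local perturbation, as a complex number. [folklore] -/
def tiltWeight (W : QuasiLocalGaugePerturbation 4 N G b) (U : GaugeConfig 4 N G) : ℂ :=
  (Real.exp (-W.total U) : ℂ)

/-- **Tilted expectation** `⟨F⟩_{μ,W} = ∫ F e^{-W} dμ / ∫ e^{-W} dμ` of a complex observable under the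
reference measure `μ` tilted by `e^{-W}` (junk `0` conventions of the Bochner integral / division). For
`μ = wilsonMeasure ρ β` this is D1's `W.expectation ρ β`. [folklore] -/
def tiltExpect (μ : Measure (GaugeConfig 4 N G)) (W : QuasiLocalGaugePerturbation 4 N G b)
    (F : GaugeConfig 4 N G → ℂ) : ℂ :=
  (∫ U, F U * tiltWeight W U ∂μ) / ∫ U, tiltWeight W U ∂μ

/-- **Tilted covariance** `⟨F G⟩_{μ,W} - ⟨F⟩_{μ,W} ⟨G⟩_{μ,W}`. [folklore] -/
def tiltCov (μ : Measure (GaugeConfig 4 N G)) (W : QuasiLocalGaugePerturbation 4 N G b)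
    (F F' : GaugeConfig 4 N G → ℂ) : ℂ :=
  tiltExpect μ W (fun U => F U * F' U) - tiltExpect μ W F * tiltExpect μ W F'

/-- A parent map `p` on `Fin n` encodes a ROOTED SPANNING TREE: one root `r = p r`, and every vertex
reaches `r` after `n` steps (so the edges `{i, p i}`, `i ≠ r`, form a spanning tree, each counted once). [folklore] -/
def IsParentTree {n : ℕ} (p : Fin n → Fin n) : Prop :=
  ∃ r : Fin n, p r = r ∧ ∀ i, p^[n] i = r

/-- **All-order tree mixing at block scale `b`** of a measure `μ` on torus configurations, constants
`(C, m)`: for every `n`, every family of functions `f_i` that are measurable, bounded by `1` and local on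
a polymer `X_i` (a finite set of block corners; `f_i` reads only the links of the cubes of `X_i`,
`polymerEdges`), and every spanning tree `p` on the indices, the joint cumulant (Ursell function, tree
`ursell`) obeys `|κ(f_1,…,f_n)| ≤ Cⁿ · n! · ∏|X_i| · exp(-(m/b) · Σ_i dist(X_i, X_{p i}))`, where
`dist` is any lower bound `D_i` of the torus distances between the sites of `X_i` and of `X_{p i}` (the
root contributes `D_r = 0`). This is the tree-decay-of-semi-invariants face of Dobrushin–Shlosman
complete analyticity, in the `n!`-with-minimal-tree normalisation (weakest of the standard forms; the
one a Kotecký–Preiss expansion around `μ` consumes) and with the support dependence linear per function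
(sum over the attachment point). [cite: DobrushinShlosman1987, §1 (conditions III)] -/
def TreeMixing (μ : Measure (GaugeConfig 4 N G)) (b : ℕ) (C m : ℝ) : Prop :=
  ∀ (n : ℕ) (X : Fin n → Finset (Site 4 N)) (f : Fin n → GaugeConfig 4 N G → ℝ),
    (∀ i, X i ∈ polymers (d := 4) (L := N) b) → (∀ i, (X i).Nonempty) →
    (∀ i, Measurable (f i)) → (∀ i, DependsOn (f i) (↑(polymerEdges b (X i)) : Set (Edge 4 N))) →
    (∀ i U, |f i U| ≤ 1) →
    ∀ p : Fin n → Fin n, IsParentTree p →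
    ∀ D : Fin n → ℝ, (∀ i, 0 ≤ D i) →
      (∀ i, ∀ y ∈ X i, ∀ y' ∈ X (p i), D i ≤ (torusDist y y' : ℝ)) →
        |ursell μ (fun (F : GaugeConfig 4 N G → ℝ) U => F U) f| ≤
          C ^ n * (n.factorial : ℝ) * (∏ i, ((X i).card : ℝ)) * Real.exp (-(m / (b : ℝ)) * ∑ i, D i)

/-- **Exponential clustering of the tilted measure** `e^{-W} μ / Z` for `r`-local block observables,
constants `(C′, m′)`: for block corners `x, y` and complex observables `f, g` measurable, bounded by `1`,
`f` reading only links whose cube lies within torus distance `r·b` of `x` (resp. `g`, `y`),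
`‖⟨f g⟩ - ⟨f⟩⟨g⟩‖ ≤ C′ exp(-(m′/b) · dist(x, y))`. [cite: KoteckyPreiss1986, Thm. 1] -/
def TiltedClustering (μ : Measure (GaugeConfig 4 N G)) (W : QuasiLocalGaugePerturbation 4 N G b)
    (r : ℕ) (C' m' : ℝ) : Prop :=
  ∀ x ∈ blockCorners (d := 4) (L := N) b, ∀ y ∈ blockCorners (d := 4) (L := N) b,
    ∀ (f g : GaugeConfig 4 N G → ℂ), Measurable f → Measurable g →
      (∀ U, ‖f U‖ ≤ 1) → (∀ U, ‖g U‖ ≤ 1) →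
      DependsOn f {e : Edge 4 N | torusDist (blockCorner b e.1) x ≤ r * b} →
      DependsOn g {e : Edge 4 N | torusDist (blockCorner b e.1) y ≤ r * b} →
        ‖tiltCov μ W f g‖ ≤ C' * Real.exp (-(m' / (b : ℝ)) * (torusDist x y : ℝ))

/-- **Range control** of a quasi-local perturbation (the (h4) repair of `RobustYangMills`, stmt-13897
rev 4, witness W-pair): a polymer whose activity is not identically zero has torus diameter at most
`b · |X|` — D1 polymers need not be connected and `NormLE` charges only `e^{κ|X|}`, so without this a
KP-small `W` may couple two cubes at arbitrary range and no clustering can follow. [folklore] -/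
def IsRangeControlled (W : QuasiLocalGaugePerturbation 4 N G b) : Prop :=
  ∀ X ∈ polymers (d := 4) (L := N) b, ∀ U, W.act X U ≠ 0 →
    ∀ y ∈ X, ∀ y' ∈ X, (torusDist y y' : ℝ) ≤ (b : ℝ) * X.card

end Lattice

/-- **Block representation of lattice QCD at one `(k, S)`** (the bridge identity): for every BOUNDED
observable `F` of the gauge field that is measurable for the axial block σ-algebra at scale `b`, the
unquenched lattice-QCD expectation on the torus of side `2S+1` at `(β, m_q)` (tree `qcdTorusExpect`,
signed determinant, `F` inserted as a scalar of the quark Grassmann algebra) EQUALS the expectation of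
`F` under the Wilson measure at `β_eff` tilted by `e^{-W}`. In words: blocked to scale `ℓ₀`, lattice QCD
with heavy quarks IS blocked pure Yang–Mills at the matched coupling times `e^{-W(V)}`; the identity
fixes `β_eff` non-perturbatively and contains block-conditioned positivity of the signed quark weight
(card `rao-blackwell-sign`). [cite: Balaban1988Convergent, p. 243 (0.1) and p. 258 (2.23)] -/
def BlockRep {Nf : ℕ} (β : ℝ) (mq : Fin Nf → ℝ) (S : ℕ) (b : ℕ) (βeff : ℝ)
    (W : QuasiLocalGaugePerturbation 4 (2 * S + 1) SU3 b) : Prop :=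
  ∀ F : GaugeConfig 4 (2 * S + 1) SU3 → ℝ, @Measurable _ _ (blockSigma b) inferInstance F →
    (∃ B : ℝ, ∀ U, |F U| ≤ B) →
      qcdTorusExpect β (2 * S + 1) mq (fun U => algebraMap ℂ (FermiAlg Nf (2 * S + 1)) (F U : ℂ)) =
        tiltExpect (wilsonMeasure (d := 4) (L := 2 * S + 1) ρ₃ βeff) W (fun U => (F U : ℂ))

/-! ## §1 The stubs -/

/-- **MixingYM** — the Yang–Mills input (open-problem strength; different in KIND from
`HeavyThresholdYMBridge.RobustYangMills`: no action-direction clause, no continuum clause; stronger than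
`YMLatticeGapAlongAFSequences` 8796 in being all-order, β-UNIFORM and stated at every block fraction):
for every block fraction `t > 0` there are constants `C, m > 0` such that along ALL scaling data
`(a_k → 0, a_k L_k → ∞)` and EVERY `N_f = 0` two-loop asymptotically free coupling sequence `β′` with
parameter `Λ′` (`β′_k - afBeta 0 Λ′ a_k → 0`), eventually in `k`, on every torus of side `2S+1 ≥ 2L_k+1`,
the `SU(3)` Wilson measure at `β′_k` is tree-mixing at block scale `b_k = ⌊t/(Λ′ a_k)⌋` with constants
`(C, m)`: truncated correlations of all orders of bounded cube-local observables decay at rate `m` per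
block (= physical rate `m Λ′/t`), uniformly in the volume. WHY IT MIGHT FAIL: complete-analyticity-type
mixing on tori for weak-to-strong crossover Yang–Mills, uniformly along all a.f. sequences (β-universality)
— the lattice half of the Millennium gap in its strongest finite-volume form; rigorous only at strong
coupling (cluster expansion). Not for provers now. [cite: DobrushinShlosman1987, §1] [cite: JaffeWitten2000, §5] -/
def MixingYM : Prop :=
  ∀ t : ℝ, 0 < t → ∃ C m : ℝ, 0 < m ∧
    ∀ (a : ℕ → ℝ) (L : ℕ → ℕ), (∀ k, 0 < a k) → Tendsto a atTop (𝓝 0) →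
      Tendsto (fun k => a k * L k) atTop atTop →
      ∀ (β' : ℕ → ℝ) (Λ' : ℝ), 0 < Λ' → Tendsto (fun k => β' k - afBeta 0 Λ' (a k)) atTop (𝓝 0) →
        ∀ᶠ k in atTop, ∀ S : ℕ, L k ≤ S →
          TreeMixing (wilsonMeasure (d := 4) (L := 2 * S + 1) ρ₃ (β' k)) (blockFactor t Λ' (a k)) C m

/-- **KPTransfer** — Kotecký–Preiss around a MIXING (non-product) reference, abstract lattice theorem
(any group `G`, any torus, any block scale): given a locality radius `r` and constants `(C, m, κ)` there
are a smallness threshold `ε₀ > 0` and output constants `(C′, m′ > 0)` such that for every probability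
measure `μ` on torus configurations that is tree-mixing at block scale `b` with constants `(C, m)` and
every range-controlled quasi-local perturbation `W` at scale `b` with weighted norm
`sup_y Σ_{X ∋ y} ‖W_X‖_∞ e^{κ|X|} ≤ ε₀` (D1 `NormLE κ ε₀`), the tilted measure `e^{-W}μ/Z` clusters
exponentially for `r`-local block observables with constants `(C′, m′)`. Mechanism: Mayer-expand
`e^{-W} = e^{-W_∅} ∏ (1 + f_X)`; clusters = finite sets of polymers with activity the reference cumulant
`κ(f_X : X ∈ P)`; tree mixing + tree-graph counting make the pinned cluster sum geometric, the
per-correlation-volume factor `Σ_y e^{-(m/b) d(y,0)} ~ (1 + 1/m)⁴` being absorbed into `ε₀(C, m, κ, r)`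
(this is where the card's "small per correlation volume, not per block" lives). WHY IT MIGHT FAIL: no
printed theorem expands around a non-product reference with `(ξ/ℓ₀)⁴ → ∞` polymers per correlation
volume (triage r1-1); the statement only needs it at FIXED `(C, m)` with `ε₀` free, which is the classical
regime of expansions around a strongly mixing reference (Bertini–Cirillo–Olivieri: polymer expansion of
`e^{-W}` against a reference whose truncated expectations have tree decay, J. Stat. Phys. 97 (1999) §§3–5,
and their graded cluster expansion, CMP 258 (2005) 405). [cite: KoteckyPreiss1986, Thm. 1] [cite: BertiniCirilloOlivieri1999, §3–§5] [cite: FriedliVelenik2017, Thm. 5.4] -/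
def KPTransfer : Prop :=
  ∀ (G : Type) [Group G] [MeasurableSpace G] (r : ℕ) (C m κ : ℝ), 0 < m → 0 < κ →
    ∃ ε₀ : ℝ, 0 < ε₀ ∧ ∃ C' m' : ℝ, 0 < m' ∧
      ∀ (N b : ℕ) [NeZero N] (μ : Measure (GaugeConfig 4 N G)) [IsProbabilityMeasure μ]
        (W : QuasiLocalGaugePerturbation 4 N G b),
        TreeMixing μ b C m → W.NormLE κ ε₀ → IsRangeControlled W → TiltedClustering μ W r C' m'

/-- **FlowComparison** — THE BET of the line (the card's FlowComparison + RoughCubeDecoupling, in the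
fixed-fraction form). For `N_f ∈ {2,3}` and every HONEST regularisation there is a format constant
`κ > 0` such that for every ratio bound `Rm ≥ 1`, block fraction `t ∈ (0,1]`, target smallness `ε > 0`,
heaviness target `H` and scale floor `Λlo` there is a threshold `M₁` above which, for every
`Rm`-TEMPERED mass tuple (`m_f ≤ Rm · m_g`), one finds: the matched `N_f = 0` parameter `Λ′ ≥ Λlo`
(CouplingMatching: `Λ′ = Λ^{1-2N_f/33} ∏ m_f^{2/33}`, up to the non-perturbative `O(g²(ℓ₀))` correction
of matching at scale `ℓ₀ = t/Λ′`), with all quarks `H`-heavy at the block scale (`H Λ′ ≤ t m_f`, i.e.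
`ℓ₀ m_f ≥ H`), an a.f. sequence `β_eff` with that parameter, and block perturbations `W_{k,S}` at scale
`b_k = ⌊t/(Λ′ a_k)⌋` such that, eventually in `k` and for all `S ≥ L_k`: the block representation
`BlockRep` holds (blocked QCD = blocked YM at `β_eff` tilted by `e^{-W}`), `‖W_{k,S}‖_{b,κ} ≤ ε`, and
`W_{k,S}` is range-controlled. Mechanism: the route's interleaved flow (8891) carries the quarks to the
block scale; the marginal `F²` part of the quark-induced action is absorbed EXACTLY in `β_eff` (Disproof
§9(i): it diverges in `k`, so it must be), and the remainder is `O((ℓ₀ M₀)⁻²) = O(t⁻² (Λ′/M₀)²)` per block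
in the weighted SUP norm over ALL block fields. WHY IT MIGHT FAIL: (a) RoughCubeDecoupling — on block
fields with up to `D* ≈ 1/b₀ ≈ 14` units of blocked plaquette deficit per cube (abundant per correlation
volume) the residual must still be `(ℓ₀M₀)⁻²`-small, a non-perturbative decoupling statement inside
Bałaban's large-field class; (b) positivity of the fibre-averaged signed determinant for `N_f = 3` / split
masses on the honest branch (card `rao-blackwell-sign`); (c) no fermionic flow with a dynamical non-abelian
field exists (crux 8891). [cite: Balaban1988Convergent, §2] [cite: AppelquistCarazzone1975] [cite: HasenfratzDegrand1994] -/
def FlowComparison : Prop :=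
  ∀ Nf : ℕ, Nf = 2 ∨ Nf = 3 → ∀ reg : QCDRegularisation Nf, Honest reg →
    ∃ κ : ℝ, 0 < κ ∧ ∀ (Rm t ε H Λlo : ℝ), 1 ≤ Rm → 0 < t → t ≤ 1 → 0 < ε →
      ∃ M₁ : ℝ, ∀ m : Fin Nf → ℝ, (∀ f, M₁ < m f) → (∀ f g, m f ≤ Rm * m g) →
        ∃ (Λ' : ℝ) (βeff : ℕ → ℝ)
          (W : (k S : ℕ) → QuasiLocalGaugePerturbation 4 (2 * S + 1) SU3 (blockFactor t Λ' (reg.a k))),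
          Λlo ≤ Λ' ∧ 0 < Λ' ∧ (∀ f, H * Λ' ≤ t * m f) ∧
          Tendsto (fun k => βeff k - afBeta 0 Λ' (reg.a k)) atTop (𝓝 0) ∧
          ∀ᶠ k in atTop, ∀ S : ℕ, reg.L k ≤ S →
            BlockRep (reg.β k) (fun f => (reg.scheme m 0 0).mq f k) S (blockFactor t Λ' (reg.a k))
                (βeff k) (W k S) ∧
              (W k S).NormLE κ ε ∧ IsRangeControlled (W k S)

/-- **FineFromBlock** — fine lattice-QCD clustering from block clustering (the card's "undo the
blocking + heavy quark lines"). There is a locality radius `r` such that for `N_f ∈ {2,3}` and every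
honest regularisation there are a block-fraction ceiling `t₀ > 0`, a scale floor `Λlo` and a heaviness
`H` with: for every mass tuple and handover data `(t ≤ t₀, Λ′ ≥ Λlo, β_eff` a.f. with `Λ′`, block
perturbations `W)` such that every quark is `H`-heavy at the block scale and the block representation
`BlockRep` holds eventually in `k` for all `S ≥ L_k`, IF the tilted Wilson measures cluster exponentially
for `r`-local block observables with some constants `(C′, m′ > 0)` eventually in `k` for all `S ≥ L_k`,
THEN lattice QCD along `reg.scheme m 0 0` has a volume-uniform lattice gap (`LatticeGapped`; rate
`≥ min(m′,1)/ℓ₀` in physical units). Mechanism: conditional expectations `E[A | block σ-algebra]` of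
fine gauge-invariant observables are bounded block functions, `r`-local up to `e^{-dist/ℓ₀}` tails and
conditionally decorrelated given the block field (the fluctuation measure at an asymptotically free
block scale `ℓ₀ = t/Λ′ ≤ t₀/Λlo` has correlation length `O(ℓ₀)` — triage r1-2: "honest here, contrast the
3 fm card"); quark-carrying observables reduce to gauge functionals times heavy quark lines decaying like
`e^{-c M n a_k}` (block-scale coercivity — NOT the fine accretivity 8875, which is void at the scheme's
eventually negative bare masses, Disproof §9(ii) / `Negative.FreeWilsonModes.numericalRange_neg_of_mass_neg`).
WHY IT MIGHT FAIL: uniform-in-`V` decorrelation of axially constrained fluctuation fields incl. Bałaban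
large fields, and configuration-wise heavy-quark propagator decay at scale `ℓ₀` for a TUNED (supercritical)
Wilson mass, are both unproved. [cite: Balaban1984Propagators, §1] [cite: Balaban1988Convergent, §2] -/
def FineFromBlock : Prop :=
  ∃ r : ℕ, ∀ Nf : ℕ, Nf = 2 ∨ Nf = 3 → ∀ reg : QCDRegularisation Nf, Honest reg →
    ∃ t₀ Λlo H : ℝ, 0 < t₀ ∧
      ∀ (m : Fin Nf → ℝ) (t Λ' : ℝ) (βeff : ℕ → ℝ)
        (W : (k S : ℕ) → QuasiLocalGaugePerturbation 4 (2 * S + 1) SU3 (blockFactor t Λ' (reg.a k))),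
        0 < t → t ≤ t₀ → Λlo ≤ Λ' → 0 < Λ' → (∀ f, H * Λ' ≤ t * m f) →
        Tendsto (fun k => βeff k - afBeta 0 Λ' (reg.a k)) atTop (𝓝 0) →
        (∀ᶠ k in atTop, ∀ S : ℕ, reg.L k ≤ S →
            BlockRep (reg.β k) (fun f => (reg.scheme m 0 0).mq f k) S (blockFactor t Λ' (reg.a k))
              (βeff k) (W k S)) →
        ∀ (C' m' : ℝ), 0 < m' →
          (∀ᶠ k in atTop, ∀ S : ℕ, reg.L k ≤ S →
              TiltedClustering (wilsonMeasure (d := 4) (L := 2 * S + 1) ρ₃ (βeff k)) (W k S) r C' m') →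
          LatticeGapped reg m

/-- **LightRemnantLatticeGap** — the hierarchical tuples (FINDING; NOT addressed by this idea nor by any
sibling card): for `N_f ∈ {2,3}` and every honest regularisation there are a ratio bound `Rm ≥ 1` and a
threshold `M₂` such that every tuple above `M₂` with SOME ratio `m_f/m_g > Rm` still has a volume-uniform
lattice gap. Content: along such hierarchies the lightest flavours are light relative to the effective
scale `Λ′(m)` of the theory with the heavier flavours decoupled (`N_f = 3`: chiral `N_f = 2`;
`N_f = 2`: light `N_f = 1`), so this is the lattice gap of few-LIGHT-flavour QCD (massive pions / the
`N_f = 1` pseudoscalar), as hard as the summit's gap clause in that regime; filed so that the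
composition is honest about what the handover covers. WHY IT MIGHT FAIL: it is the light-quark lattice
gap, uniformly in the volume, with no Yang–Mills reduction available. [cite: JaffeWitten2000, §5] [cite: AppelquistCarazzone1975] -/
def LightRemnantLatticeGap : Prop :=
  ∀ Nf : ℕ, Nf = 2 ∨ Nf = 3 → ∀ reg : QCDRegularisation Nf, Honest reg →
    ∃ Rm : ℝ, 1 ≤ Rm ∧ ∃ M₂ : ℝ, ∀ m : Fin Nf → ℝ, (∀ f, M₂ < m f) →
      (∃ f g, Rm * m g < m f) → LatticeGapped reg m

/-- Stub: the continuum half (route item stmt-QuantumFields-8923, `GradientFlowSpecies.GapTransfer`). -/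
theorem stub_gapTransfer : Summit.QuantumFields.QCD.Theses.GradientFlowSpecies.GapTransfer := by
  sorry

/-- Stub: the Yang–Mills input. -/
theorem stub_MixingYM : MixingYM := by
  sorry

/-- Stub: Kotecký–Preiss around a mixing reference. -/
theorem stub_KPTransfer : KPTransfer := by
  sorry

/-- Stub: the bet — block representation with a small, range-controlled perturbation. -/
theorem stub_FlowComparison : FlowComparison := by
  sorry

/-- Stub: fine clustering from block clustering and heavy quark lines. -/
theorem stub_FineFromBlock : FineFromBlock := by
  sorry

/-- Stub: the hierarchical (few-light-flavour) remnant. -/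
theorem stub_LightRemnantLatticeGap : LightRemnantLatticeGap := by
  sorry

/-! ## §2 Composition (real proofs) -/

/-- **The lattice half, per-regularisation threshold form** (`C⁺` of the shared head
`existence-pays-the-continuum-half`, = `GradientFlowSpecies.MassiveLatticeGap` up to `Iff`, triage r1-3):
from the five mechanism stubs. Order of choices: `Rm, M₂` (remnant) → `r` and `t₀, Λlo, H` (unblocking)
→ `t = min t₀ 1` → `(C, m)` (mixing at fraction `t`) → `κ` (flow format) → `ε₀, C′, m′` (KP) → `M₁`
(flow at smallness `ε₀`) → threshold `max (max M₁ M₂) 0`; tempered tuples go through the handover,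
the others through the remnant. [folklore] -/
theorem latticeGapped_aboveThreshold (hM : MixingYM) (hK : KPTransfer) (hF : FlowComparison)
    (hB : FineFromBlock) (hL : LightRemnantLatticeGap) {Nf : ℕ} (hNf : Nf = 2 ∨ Nf = 3)
    (reg : QCDRegularisation Nf) (hreg : Honest reg) :
    ∃ M : ℝ, 0 ≤ M ∧ ∀ m : Fin Nf → ℝ, (∀ f, M < m f) → LatticeGapped reg m := by
  obtain ⟨Rm, hRm, M₂, hL'⟩ := hL Nf hNf reg hreg
  obtain ⟨r, hB'⟩ := hB
  obtain ⟨t₀, Λlo, H, ht₀, hB''⟩ := hB' Nf hNf reg hreg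
  obtain ⟨t, ht, ht1, htt₀⟩ : ∃ t : ℝ, 0 < t ∧ t ≤ 1 ∧ t ≤ t₀ :=
    ⟨min t₀ 1, lt_min ht₀ one_pos, min_le_right _ _, min_le_left _ _⟩
  obtain ⟨C, mr, hmr, hM'⟩ := hM t ht
  obtain ⟨κ, hκ, hF'⟩ := hF Nf hNf reg hreg
  obtain ⟨ε₀, hε₀, C', m', hm', hK'⟩ := hK SU3 r C mr κ hmr hκ
  obtain ⟨M₁, hF''⟩ := hF' Rm t ε₀ H Λlo hRm ht ht1 hε₀
  refine ⟨max (max M₁ M₂) 0, le_max_right _ _, fun m hm => ?_⟩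
  have hm1 : ∀ f, M₁ < m f := fun f =>
    lt_of_le_of_lt ((le_max_left M₁ M₂).trans (le_max_left _ _)) (hm f)
  have hm2 : ∀ f, M₂ < m f := fun f =>
    lt_of_le_of_lt ((le_max_right M₁ M₂).trans (le_max_left _ _)) (hm f)
  by_cases htemp : ∀ f g, m f ≤ Rm * m g
  · obtain ⟨Λ', βeff, W, hlo, hΛ', hH, hβ, hev⟩ := hF'' m hm1 htemp
    have hmix := hM' reg.a reg.L reg.a_pos reg.tendsto_a reg.tendsto_L βeff Λ' hΛ' hβ
    have hclust : ∀ᶠ k in atTop, ∀ S : ℕ, reg.L k ≤ S →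
        TiltedClustering (wilsonMeasure (d := 4) (L := 2 * S + 1) ρ₃ (βeff k)) (W k S) r C' m' := by
      filter_upwards [hev, hmix] with k hk hk' S hS
      obtain ⟨-, hnorm, hrange⟩ := hk S hS
      haveI := isProbabilityMeasure_wilsonMeasure (d := 4) (L := 2 * S + 1) ρ₃
        (continuous_fundamentalRep _) (βeff k)
      exact hK' (2 * S + 1) (blockFactor t Λ' (reg.a k))
        (wilsonMeasure (d := 4) (L := 2 * S + 1) ρ₃ (βeff k)) (W k S) (hk' S hS) hnorm hrange
    exact hB'' m t Λ' βeff W ht htt₀ hlo hΛ' hH hβ (hev.mono fun k hk S hS => (hk S hS).1) C' m' hm'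
      hclust
  · simp only [not_forall, not_le] at htemp
    obtain ⟨f, g, hfg⟩ := htemp
    exact hL' m hm2 ⟨f, g, hfg⟩

/-- **The head** (card `existence-pays-the-continuum-half`, kernel-checked by triage r1-1/r1-3 and
re-proved here against this file's `Honest`/`LatticeGapped`): the continuum half `GapTransfer` plus the
per-regularisation threshold lattice gap give the crux, the threshold being removed by the landed
`GluonicCompletion.Negative.qcdOf_iff_threshold` (shift of `m_crit`). [folklore] -/
theorem handover_of_gapTransfer_of_latticeGapped (hGT : GradientFlowSpecies.GapTransfer)
    (hH : ∀ Nf : ℕ, Nf = 2 ∨ Nf = 3 → ∀ reg : QCDRegularisation Nf, Honest reg →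
      ∃ M : ℝ, 0 ≤ M ∧ ∀ m : Fin Nf → ℝ, (∀ f, M < m f) → LatticeGapped reg m) :
    ContinuumQCDExists → _root_.QCD := by
  intro hX
  have key : ∀ Nf, (Nf = 2 ∨ Nf = 3) → QCDOf Nf := by
    intro Nf hNf
    obtain ⟨reg, hms, hb⟩ := hX Nf hNf
    obtain ⟨M₀, hM₀, hgap⟩ := hH Nf hNf reg ⟨hms, hb⟩
    refine (Theorems.GluonicCompletion.Negative.qcdOf_iff_threshold Nf).mpr
      ⟨M₀, hM₀, reg, hms, fun m hm => ?_⟩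
    have hm0 : ∀ f, 0 < m f := fun f => lt_of_le_of_lt hM₀ (hm f)
    obtain ⟨z, shift, T, hA, hN, hG, hP⟩ := hb m hm0
    obtain ⟨Δ, hΔ, hL⟩ := hgap m hm
    have hL' : (reg.scheme m z shift).HasLatticeMassGap Δ :=
      (Theorems.RobustYangMillsHandover.Negative.hasLatticeMassGap_scheme_indep reg m 0 0 z shift Δ).mp hL
    refine ⟨z, shift, T, hA, hN, hG, hP, Δ / 2, half_pos hΔ, ?_, ?_⟩
    · exact hGT Nf (reg.scheme m z shift) T Δ (Δ / 2) (half_pos hΔ) (half_lt_self hΔ) hA hL'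
    · exact Theorems.RobustYangMillsHandover.Negative.hasLatticeMassGap_anti _ (half_le_self hΔ.le) hL'
  exact ⟨key 2 (Or.inl rfl), key 3 (Or.inr rfl)⟩

/-- **Composition of the line, hypotheses form**: the six stub STATEMENTS imply the crux (stated as
its body `ContinuumQCDExists → QCD`, to which `RobustYangMillsHandover` unfolds, so that the audited
skeleton theorem below is the only one concluding the route decl by name). [folklore] -/
theorem RobustYangMillsHandover_of_parts (hGT : GradientFlowSpecies.GapTransfer) (hM : MixingYM)
    (hK : KPTransfer) (hF : FlowComparison) (hB : FineFromBlock) (hL : LightRemnantLatticeGap) :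
    ContinuumQCDExists → _root_.QCD :=
  handover_of_gapTransfer_of_latticeGapped hGT fun _ hNf reg hreg =>
    latticeGapped_aboveThreshold hM hK hF hB hL hNf reg hreg

/-- **The skeleton**: the crux BY NAME from the six registered stubs (`sorry` only inside `stub_*`;
when all six land, this theorem is the proof of stmt-QuantumFields-8892). [folklore] -/
theorem RobustYangMillsHandover_of : RobustYangMillsHandover :=
  RobustYangMillsHandover_of_parts stub_gapTransfer stub_MixingYM stub_KPTransfer stub_FlowComparison
    stub_FineFromBlock stub_LightRemnantLatticeGap


/-! ## §3 Arithmetic recorded by the card and by the FINDING (proved) -/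

/-- **The card's window identity** (its `WindowLemma`, algebraic core): with `ξ = 1/Λ′` and the
geometric-mean handover length `ℓ₀ = ξ s`, `s⁶ = Λ′/M` (i.e. `s = (Λ′/M)^{1/6}`), the per-correlation-
volume size of an `(ℓ₀M)⁻²`-activity is exactly the threshold slack: `(ξ/ℓ₀)⁴ · ((ℓ₀ M)²)⁻¹ = Λ′/M`, and
the block scale in Yang–Mills units is `ℓ₀ Λ′ = s`. [folklore] -/
theorem window_identity {Λ' M s : ℝ} (hΛ : 0 < Λ') (hM : 0 < M) (hs : 0 < s) (hs6 : s ^ 6 * M = Λ') :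
    ((1 / Λ') / ((1 / Λ') * s)) ^ 4 * (((1 / Λ') * s * M) ^ 2)⁻¹ = Λ' / M ∧ (1 / Λ') * s * Λ' = s := by
  have hΛ0 : Λ' ≠ 0 := hΛ.ne'
  have hM0 : M ≠ 0 := hM.ne'
  have hs0 : s ≠ 0 := hs.ne'
  refine ⟨?_, by field_simp⟩
  have e1 : (1 / Λ') / ((1 / Λ') * s) = 1 / s := by field_simp
  have e2 : (1 / Λ') * s * M = s * M / Λ' := by ring
  rw [e1, e2]
  field_simp
  linear_combination (-1 : ℝ) * hs6

/-- **The matched pure-gauge scale** `Λ′(m) = Λ^{1-2N_f/33} ∏_f m_f^{2/33}` of an `N_f`-flavour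
regularisation with Λ-parameter `Λ` after all quarks (RGI masses `m_f`) are decoupled — the `Λ′` of
`HeavyThresholdYMBridge.CouplingMatching` (stmt-8797), iterated flavour by flavour
(`b₀(N_f) = (11 - 2N_f/3)/(16π²)`). [cite: AppelquistCarazzone1975] -/
def matchedScale (Nf : ℕ) (Λ : ℝ) (m : Fin Nf → ℝ) : ℝ :=
  Λ ^ (1 - 2 * (Nf : ℝ) / 33) * ∏ f, m f ^ ((2 : ℝ) / 33)

/-- **FINDING, arithmetic**: along the `N_f = 3` hierarchy `(M, M, s)` with the two light masses FIXED
at `M`, the handover parameter `Λ′(m)/m_min = Λ^{27/33} M^{4/33} s^{2/33} / M` tends to `+∞` as the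
heavy mass `s → ∞` — the lightest quarks become light relative to the effective scale, for every
threshold `M`. Hence no per-regularisation threshold puts all tuples in the heavy regime. [folklore] -/
theorem matchedScale_ratio_tendsto_atTop {Λ M : ℝ} (hΛ : 0 < Λ) (hM : 0 < M) :
    Tendsto (fun s : ℝ => matchedScale 3 Λ ![M, M, s] / M) atTop atTop := by
  have hc : 0 < Λ ^ (1 - 2 * ((3 : ℕ) : ℝ) / 33) * (M ^ ((2 : ℝ) / 33) * M ^ ((2 : ℝ) / 33)) / M := by
    positivity
  have key : Tendsto (fun s : ℝ =>
      Λ ^ (1 - 2 * ((3 : ℕ) : ℝ) / 33) * (M ^ ((2 : ℝ) / 33) * M ^ ((2 : ℝ) / 33)) / M * s ^ ((2 : ℝ) / 33))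
      atTop atTop :=
    (tendsto_rpow_atTop (by norm_num)).const_mul_atTop hc
  refine key.congr fun s => ?_
  simp only [matchedScale, Fin.prod_univ_three, Matrix.cons_val_zero, Matrix.cons_val_one,
    Matrix.cons_val_two, Matrix.head_cons, Matrix.tail_cons]
  ring

end Summit.QuantumFields.QCD.Cruxes.RobustYangMillsHandover.GeometricMeanHandover

end
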